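import Mathlib
import Literature.Geometry.DiscreteGeometry.TwoShellPatterns

/-!
# Crux `NearFarGlueR` (stmt-AtomisticToContinuum-14970), line `Sketch`: stub `stub_coverHcp`

The geometric input of the descent lemma of the line for the hcp pattern: the twelve first-shell
directions of the hcp two-shell pattern (the anticuboctahedron
`hcpKissingPattern ⊆ hcpTwoShellPattern`) `1/4`-cover the unit sphere — for every unit vector `w`
there is a first-shell (unit) pattern vector `v` with `⟪v, w⟫ ≥ 1/4`.

Proof (moment method).  Let `u_1, …, u_12 ∈ ℤ³` be the integer model `hcpInt` and
`v_k = u_k/√18` the twelve unit vectors, `p_k = ⟪v_k, w⟫`.  The integer vectors satisfy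
`Σ_k u_k = 0` and `Σ_k (u_k)_i (u_k)_j = 72 δ_ij`, so `Σ p_k = 0` and
`Σ p_k² = (72/18) ‖w‖² = 4` (polynomial identities in the coordinates of `w`).  If all
`p_k < 1/4`, then together with `p_k ≥ -1` (Cauchy–Schwarz) we get `p_k² ≤ 1/4 - (3/4) p_k` for
each `k`, whence `Σ p_k² ≤ 3 - (3/4) Σ p_k = 3 < 4`, a contradiction (`linarith` on the twelve
quadratic bounds, the monomials in the coordinates of `w` being the atoms).
-/

noncomputable section

namespace Summit.AtomisticToContinuum.Crystallization.Theorems.PhononSlackCertificatesNearFarGlueR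

open Literature.Geometry.DiscreteGeometry
open scoped BigOperators RealInnerProductSpace

/-- The inner product of a scaled integer vector `(a, b, d)/√18` with `w`, in coordinates.
[folklore] -/
theorem coverHcp_inner (a b d : ℤ) (w : EuclideanSpace ℝ (Fin 3)) :
    ⟪(Real.sqrt 18)⁻¹ • intVec ![a, b, d], w⟫ =
      (Real.sqrt 18)⁻¹ * (a * w 0 + b * w 1 + d * w 2) := by
  rw [real_inner_smul_left]
  simp only [PiLp.inner_apply, RCLike.inner_apply, conj_trivial, Fin.sum_univ_three,
    intVec_apply, Matrix.cons_val_zero, Matrix.cons_val_one, Matrix.cons_val_two,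
    Matrix.head_cons, Matrix.tail_cons]
  ring

/-- The elementary quadratic bound: `-1 ≤ p < 1/4` implies `p² ≤ 1/4 - (3/4) p`
(i.e. `(p + 1) (1/4 - p) ≥ 0`). [folklore] -/
theorem coverHcp_quad {p : ℝ} (h1 : -1 ≤ p) (h2 : p < 1 / 4) :
    p ^ 2 ≤ 1 / 4 - 3 / 4 * p := by
  nlinarith [mul_nonneg (show (0 : ℝ) ≤ p + 1 by linarith) (show (0 : ℝ) ≤ 1 / 4 - p by linarith)]

/-- The key step: if no unit vector of the hcp two-shell pattern has inner product `≥ 1/4` with the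
unit vector `w`, then for each `u = (a, b, d) ∈ hcpInt` the number `p = ⟪u/√18, w⟫` satisfies
`p² ≤ 1/4 - (3/4) p` (from `-1 ≤ p < 1/4`, the lower bound by Cauchy–Schwarz since
`‖u/√18‖ = ‖w‖ = 1`). [folklore] -/
theorem coverHcp_key (w : EuclideanSpace ℝ (Fin 3)) (hw : ‖w‖ = 1)
    (h : ∀ v ∈ hcpTwoShellPattern, ‖v‖ = 1 → ⟪v, w⟫ < 1 / 4) (a b d : ℤ)
    (hu : ![a, b, d] ∈ hcpInt) :
    ((Real.sqrt 18)⁻¹ * (a * w 0 + b * w 1 + d * w 2)) ^ 2 ≤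
      1 / 4 - 3 / 4 * ((Real.sqrt 18)⁻¹ * (a * w 0 + b * w 1 + d * w 2)) := by
  have hmem : (Real.sqrt 18)⁻¹ • intVec ![a, b, d] ∈ hcpKissingPattern :=
    Finset.mem_image_of_mem _ hu
  have hv : ‖(Real.sqrt 18)⁻¹ • intVec ![a, b, d]‖ = 1 :=
    norm_eq_one_of_mem_hcpKissingPattern hmem
  have hlt := h _ (hcpKissingPattern_subset hmem) hv
  have hge : -1 ≤ ⟪(Real.sqrt 18)⁻¹ • intVec ![a, b, d], w⟫ := by
    have habs := abs_real_inner_le_norm ((Real.sqrt 18)⁻¹ • intVec ![a, b, d]) w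
    rw [hv, hw, one_mul] at habs
    exact (abs_le.1 habs).1
  rw [coverHcp_inner] at hlt hge
  exact coverHcp_quad hge hlt

/-- **The anticuboctahedron directions `1/4`-cover the sphere** (stub `stub_coverHcp` of line
`Sketch` of crux `NearFarGlueR`): for every unit vector `w` of `ℝ³` some unit vector `v` of the hcp
two-shell pattern has `⟪v, w⟫ ≥ 1/4`.  By the moment method: the twelve first-shell directions
`v_k` have `Σ ⟪v_k, w⟫ = 0` and `Σ ⟪v_k, w⟫² = 4`, incompatible with all `⟪v_k, w⟫ < 1/4`.
[folklore] -/
theorem stub_coverHcp :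
    ∀ w : EuclideanSpace ℝ (Fin 3), ‖w‖ = 1 →
      ∃ v ∈ hcpTwoShellPattern, ‖v‖ = 1 ∧ (1 / 4 : ℝ) ≤ ⟪v, w⟫ := by
  intro w hw
  by_contra h
  push Not at h
  have hw2 : w 0 ^ 2 + w 1 ^ 2 + w 2 ^ 2 = 1 := by
    have hsq := EuclideanSpace.real_norm_sq_eq w
    rw [hw, one_pow, Fin.sum_univ_three] at hsq
    linarith
  have hc : ((Real.sqrt 18)⁻¹) ^ 2 * (w 0 ^ 2 + w 1 ^ 2 + w 2 ^ 2) = 1 / 18 := by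
    rw [hw2, mul_one, one_div, inv_pow, Real.sq_sqrt (by norm_num)]
  have q1 := coverHcp_key w hw h 3 (-3) 0 (by decide)
  have q2 := coverHcp_key w hw h (-3) 3 0 (by decide)
  have q3 := coverHcp_key w hw h 3 0 (-3) (by decide)
  have q4 := coverHcp_key w hw h (-3) 0 3 (by decide)
  have q5 := coverHcp_key w hw h 0 3 (-3) (by decide)
  have q6 := coverHcp_key w hw h 0 (-3) 3 (by decide)
  have q7 := coverHcp_key w hw h 3 3 0 (by decide)
  have q8 := coverHcp_key w hw h 3 0 3 (by decide)
  have q9 := coverHcp_key w hw h 0 3 3 (by decide)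
  have q10 := coverHcp_key w hw h (-1) (-1) (-4) (by decide)
  have q11 := coverHcp_key w hw h (-1) (-4) (-1) (by decide)
  have q12 := coverHcp_key w hw h (-4) (-1) (-1) (by decide)
  push_cast at q1 q2 q3 q4 q5 q6 q7 q8 q9 q10 q11 q12
  linarith

end Summit.AtomisticToContinuum.Crystallization.Theorems.PhononSlackCertificatesNearFarGlueR
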